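import Summits.QuantumFields.YangMills.Theorems.ForcedResponseSkewnessResponseLocalisationContactOfFemtoToolkit
import Summits.QuantumFields.YangMills.Theorems.ForcedResponseSkewnessResponseLocalisationContactOfFemtoCumulant
import HarnessLib

/-!
# Route `ForcedResponseSkewness`, crux `ResponseLocalisation` (stmt-QuantumFields-24869), line «femto-collar»: the collar transfer
# `contactKernel_of_femto : FBLPinnedSigR → NearCovLawSigR → ContactKernelSigR`

Analysis stub of the RESHAPED line (lead `ym-line-frs-p1` g3; `--supports stmt-QuantumFields-24869`).  The kernel-level physics stub of
line «collar-kernel», `ContactKernelSigR` — for a pinned unit, pairs `(y,z)` at physical torus separation in `[r₁,r₂]` and every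
`κ > 0`, a cut `R > 0` with `Σ_{x : a(β)·d_T(x,z) < R} |torusK3 β L x y z| ≤ κ·a(β)⁸` for all large `β` and all tori
`a(β)·L ≥ Λ₀` — follows from two FEMTO-CUBE statements with no torus, no volume and no unit-scale correlation in them:

* `FBLPinnedSigR`: the spine's frozen-boundary law `FBL G r a` (kernel means of the action density at depth `d` are within `C₁/d⁴` of
  `p β`, for every exterior), along the pinned unit;
* `NearCovLawSigR`: the near-pair conditional-covariance law `NearCovLaw G r a` (the exterior-dependence of `kerCov_η(dens (z+w), dens z)`
  is `≤ μ_β(w)/depth⁴` with `Σ_{a|w|<R} μ_β ≤ κ'` for the cut `R = R(κ')`), along the pinned unit.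

Proof (Georgii's conditional independence of separated volumes, one torus DLR step per site — the tree's
`abs_integral_prod_sub_mean_le`, here through the two-observable form `Femto.abs_integral_two_sub_mean_le`): with
`s = min(r₁,ℓ₁,ℓ₂)/16` and `M = ⌊s/a(β)⌋`, the radius-`M+1` cubes around `y` and around `z` are femto cubes, inject into the
torus (`4M+8 ≤ L`) and are torus-disjoint (`d_T(y,z) ≥ r₁/a(β) ≥ 16M`); for `x` in the torus ball around `z` let `x' = z + w` be its
cyclic representative (`dens x ∘ lift = dens x' ∘ lift`).  Then `κ₃(x,y,z) = ⟨(dens y − m_y)(W − ⟨W⟩)⟩` with the near observable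
`W = (dens x' − m_{x'})(dens z − m_z)` carried by the cube around `z`, whose kernel mean is
`kerCov_η(dens x', dens z) + (γ_η dens x' − m_{x'})(γ_η dens z − m_z)`: exterior-uniformly within `μ_β(w)/M⁴ + 64C₁²/M⁸` of `n_β(w)`
(near-pair law + FBL twice), while `γ_η dens y` is within `C₁/M⁴` of `p β`.  The two-observable collar bound gives
`|κ₃(x,y,z)| ≤ 4(C₁/M⁴)(μ_β(w)/M⁴ + 64C₁²/M⁸)`; summing over the ball (`Σ μ ≤ κ'`, `#ball ≤ (2R/a+1)⁴`) and `1/M ≤ 2a(β)/s` give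
`≤ κ·a(β)⁸` for `κ' = κ s⁸/(2048 C₁)` and `R ≤ κ s¹²/(2²¹·81·C₁³)`.

No summit is proved by any of this (leaf R2a `BalabanLadder.NT`, conditional rung line; the two femto statements are physics
stubs; the YM mass gap is NOT proved).  Refs: Georgii (2011) Thm. 4.17; Seiler LNP 159 Ch. 2.
-/

set_option autoImplicit false

noncomputable section

namespace Summit.QuantumFields.YangMills.Cruxes.ResponseLocalisation.Femto

open MeasureTheory Filter Topology
open Literature.MathematicalPhysics.QuantumFieldTheory Literature.MathematicalPhysics.QuantumLattice
open Literature.Probability.LatticeModels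
open Summit.QuantumFields.YangMills.Cruxes.OSLegsFromFemtoAndGap.DlrCollarTransfer
open Summit.QuantumFields.YangMills.Cruxes.RunningCouplingCeiling.Pointwise (torusDist)
open Summit.QuantumFields.YangMills.Cruxes.ResponseLocalisation.Birth

/-! ## The collar transfer -/

section Main

/-- **The collar transfer `ContactKernelSigR ⇐ FBL ∧ NearCovLaw`** (composition of line «femto-collar»; see the module
docstring).  Georgii's conditional independence of separated volumes, Thm. 4.17. [folklore] -/
theorem contactKernel_of_femto (hFBL : FBLPinnedSigR) (hNC : NearCovLawSigR) : ContactKernelSigR := by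
  intro G _ _ _ _ hG
  letI : MeasurableSpace G := borel G
  haveI : BorelSpace G := ⟨rfl⟩
  intro r a hpos hlim hpin r₁ r₂ hr₁ _hr₁₂ κ hκ
  classical
  haveI : SecondCountableTopology G :=
    (r.continuous.isClosedEmbedding r.injective).isEmbedding.secondCountableTopology
  obtain ⟨CA, hCA⟩ := r.curvature.bounded
  -- the two femto laws along the pinned unit
  obtain ⟨C₁, β₁, ℓ₁, p, hℓ₁, hC₁, hF⟩ := hFBL G hG r a hpos hlim hpin
  obtain ⟨ℓ₂, hℓ₂, hN⟩ := hNC G hG r a hpos hlim hpin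
  -- scales and constants
  set s : ℝ := min r₁ (min ℓ₁ ℓ₂) / 16 with hs
  have hmin : 0 < min r₁ (min ℓ₁ ℓ₂) := lt_min hr₁ (lt_min hℓ₁ hℓ₂)
  have hs0 : 0 < s := by rw [hs]; positivity
  have hs_r₁ : 16 * s ≤ r₁ := by
    have := min_le_left r₁ (min ℓ₁ ℓ₂); rw [hs]; linarith only [this]
  have hs_ℓ₁ : 16 * s ≤ ℓ₁ := by
    have := (min_le_right r₁ (min ℓ₁ ℓ₂)).trans (min_le_left _ _); rw [hs]; linarith only [this]
  have hs_ℓ₂ : 16 * s ≤ ℓ₂ := by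
    have := (min_le_right r₁ (min ℓ₁ ℓ₂)).trans (min_le_right _ _); rw [hs]; linarith only [this]
  set C₁' : ℝ := C₁ + 1 with hC₁'
  have hC₁'0 : 0 < C₁' := by rw [hC₁']; linarith only [hC₁]
  have hC₁le : C₁ ≤ C₁' := by rw [hC₁']; linarith only
  set κ' : ℝ := κ * s ^ 8 / (2048 * C₁') with hκ'
  have hκ'0 : 0 < κ' := by rw [hκ']; positivity
  obtain ⟨R, hR, β₂, n, μ, hμ0, hμsum, hcov⟩ := hN κ' hκ'0
  set Rf : ℝ := min (min R (s / 4)) (min 1 (κ * s ^ 12 / (2 ^ 21 * 81 * C₁' ^ 3))) with hRf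
  have hRf0 : 0 < Rf := by rw [hRf]; positivity
  have hRfR : Rf ≤ R := (min_le_left _ _).trans (min_le_left _ _)
  have hRfs : Rf ≤ s / 4 := (min_le_left _ _).trans (min_le_right _ _)
  have hRf1 : Rf ≤ 1 := (min_le_right _ _).trans (min_le_left _ _)
  have hRfκ : Rf ≤ κ * s ^ 12 / (2 ^ 21 * 81 * C₁' ^ 3) := (min_le_right _ _).trans (min_le_right _ _)
  obtain ⟨β₃, hβ₃⟩ := Filter.eventually_atTop.1 (hlim.eventually (gt_mem_nhds hRf0))
  refine ⟨Rf, hRf0, max β₁ (max β₂ β₃), 4 * s + 8, ?_⟩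
  intro β hβ L hL y _hy z _hz hsep₁ _hsep₂
  have hβ1 : β₁ ≤ β := le_trans (le_max_left _ _) hβ
  have hβ2 : β₂ ≤ β := le_trans ((le_max_left _ _).trans (le_max_right _ _)) hβ
  have hβ3 : β₃ ≤ β := le_trans ((le_max_right _ _).trans (le_max_right _ _)) hβ
  have ht0 : 0 < a β := hpos β
  have htR : a β < Rf := hβ₃ β hβ3
  have ht1 : a β ≤ 1 := by linarith only [htR, hRf1]
  have hts4 : a β ≤ s / 4 := by linarith only [htR, hRfs]
  -- the cube radius `M = ⌊s / a β⌋`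
  obtain ⟨hM4, hMle, hMge⟩ := floor_facts ht0 hts4
  set M : ℕ := ⌊s / a β⌋₊ with hM
  have hM1 : 1 ≤ M := by omega
  have hM4r : (4 : ℝ) ≤ M := by exact_mod_cast hM4
  have hMpos : (0 : ℝ) < M := by linarith only [hM4r]
  have hMt : (M : ℝ) * a β ≤ s := (le_div_iff₀ ht0).1 hMle
  have hM2t : s ≤ 2 * (M : ℝ) * a β := by
    have := (div_le_iff₀ (by positivity : (0 : ℝ) < 2 * a β)).1 hMge
    linarith only [this]
  -- torus side: injectivity radius
  haveI : NeZero (2 * L + 1) := ⟨by omega⟩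
  have h4M : 4 * M + 8 ≤ L := by
    have h1 : (4 * (M : ℝ) + 8) * a β ≤ (L : ℝ) * a β := by
      have : (4 * (M : ℝ) + 8) * a β ≤ 4 * s + 8 := by linarith only [hMt, ht1, ht0]
      linarith only [this, hL]
    have h2 : (4 * (M : ℝ) + 8) ≤ L := le_of_mul_le_mul_right h1 ht0
    exact_mod_cast h2
  -- femto cubes of side `2M+3`
  have hside : ((2 * M + 3 : ℕ) : ℝ) * a β ≤ 3 * s := by push_cast; linarith only [hMt, hts4, ht0]
  have hb₁ : ((2 * M + 3 : ℕ) : ℝ) * a β ≤ ℓ₁ := by linarith only [hside, hs_ℓ₁, hs0]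
  have hb₂ : ((2 * M + 3 : ℕ) : ℝ) * a β ≤ ℓ₂ := by linarith only [hside, hs_ℓ₂, hs0]
  -- separation of `y` and `z` on the torus
  have hdist : 2 * ((2 : ℝ) * M + 4) ≤ torusDist L y z := by
    have h1 : r₁ ≤ a β * torusDist L y z := hsep₁
    have h2 : 16 * ((M : ℝ) * a β) ≤ a β * torusDist L y z := by linarith only [h1, hMt, hs_r₁]
    have h3 : 16 * (M : ℝ) ≤ torusDist L y z := by
      have h4 : a β * (16 * (M : ℝ)) ≤ a β * torusDist L y z := by linarith only [h2]
      exact le_of_mul_le_mul_left h4 ht0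
    linarith only [h3, hM4r]
  obtain ⟨hsep_yz, hsep_zy⟩ := exists_coord_sep L M y z hdist
  -- the cubes, injectivity and far conditions
  set Qy : Finset (Literature.MathematicalPhysics.QuantumLattice.ZdEdge 4) :=
    cubeEdges (fun k => y k - (M + 1)) (2 * M + 3) with hQy
  set Qz : Finset (Literature.MathematicalPhysics.QuantumLattice.ZdEdge 4) :=
    cubeEdges (fun k => z k - (M + 1)) (2 * M + 3) with hQz
  have hinj_y := injOn_torusProj_cube h4M y
  have hinj_z := injOn_torusProj_cube h4M z
  have hfar_yz : ∀ e ∈ Qz ∪ (plaquettesTouching Qz).biUnion plaquetteEdges, ∀ e' ∈ Qy,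
      torusEdge (2 * L + 1) e ≠ torusEdge (2 * L + 1) e' :=
    fun e he e' he' => torusEdge_ne_cube hsep_yz he he'
  have hfar_zy : ∀ e ∈ Qy ∪ (plaquettesTouching Qy).biUnion plaquetteEdges, ∀ e' ∈ Qz,
      torusEdge (2 * L + 1) e ≠ torusEdge (2 * L + 1) e' :=
    fun e he e' he' => torusEdge_ne_cube hsep_zy he he'
  -- FBL at the centres
  have hFy : ∀ η, |kerE G r β (fun k => y k - (M + 1)) (2 * M + 3) η (dens G r y) - p β| ≤ C₁ / (M : ℝ) ^ 4 :=
    fun η => abs_kerE_dens_centred_sub_le r hC₁ (hF β hβ1) hM1 hb₁ y η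
  have hFz : ∀ η, |kerE G r β (fun k => z k - (M + 1)) (2 * M + 3) η (dens G r z) - p β| ≤ C₁ / (M : ℝ) ^ 4 :=
    fun η => abs_kerE_dens_centred_sub_le r hC₁ (hF β hβ1) hM1 hb₁ z η
  -- torus mean at `z`
  obtain ⟨mz, hmz⟩ : ∃ m : ℝ, m = torusE G r β L (dens G r z) := ⟨_, rfl⟩
  have hmz_p : |mz - p β| ≤ C₁ / (M : ℝ) ^ 4 := by
    rw [hmz]
    exact abs_torusMean_sub_le r β Qz Qz (continuous_dens r z) (fun U => hCA _) (isCylinder_dens_cube r hM1 z) hinj_z hFz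
  have hdz : ∀ η, |kerE G r β (fun k => z k - (M + 1)) (2 * M + 3) η (dens G r z) - mz| ≤ 2 * C₁ / (M : ℝ) ^ 4 := by
    intro η
    have e : kerE G r β (fun k => z k - (M + 1)) (2 * M + 3) η (dens G r z) - mz =
        (kerE G r β (fun k => z k - (M + 1)) (2 * M + 3) η (dens G r z) - p β) - (mz - p β) := by ring
    rw [e]
    calc |(kerE G r β (fun k => z k - (M + 1)) (2 * M + 3) η (dens G r z) - p β) - (mz - p β)|
        ≤ |kerE G r β (fun k => z k - (M + 1)) (2 * M + 3) η (dens G r z) - p β| + |mz - p β| := abs_sub _ _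
      _ ≤ C₁ / (M : ℝ) ^ 4 + C₁ / (M : ℝ) ^ 4 := add_le_add (hFz η) hmz_p
      _ = 2 * C₁ / (M : ℝ) ^ 4 := by ring
  -- tolerance for `dens y`
  set ε₁ : ℝ := C₁' / (M : ℝ) ^ 4 with hε₁
  have hε₁0 : 0 < ε₁ := by rw [hε₁]; positivity
  have hyker : ∀ η, |(∫ U, dens G r y U ∂(ymSpecification r.ρ β Qy η)) - p β| ≤ ε₁ := fun η =>
    (hFy η).trans (div_le_div_of_nonneg_right hC₁le (by positivity))
  -- depth of the centre of `Qz`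
  have hdepth_z : depth (fun k => z k - (M + 1)) (2 * M + 3) z = M + 2 := depth_centred z M
  ----------------------------------------------------------------------------------------------
  -- the per-site bound: for `x` in the near ball, `|κ₃(x,y,z)| ≤ 4 ε₁ (μ(w)/M⁴ + 64 C₁'²/M⁸)`
  ----------------------------------------------------------------------------------------------
  have key : ∀ x ∈ (box 4 L).filter (fun x => a β * torusDist L x z < Rf),
      |torusK3 G r β L x y z| ≤ 4 * ε₁ *
        (μ β (fun k => ((((x k - z k : ℤ) : ZMod (2 * L + 1))).valMinAbs : ℤ)) / (M : ℝ) ^ 4 +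
          64 * C₁' ^ 2 / (M : ℝ) ^ 8) := by
    intro x hx
    rw [Finset.mem_filter] at hx
    obtain ⟨-, hxd⟩ := hx
    set w : Fin 4 → ℤ := fun k => ((((x k - z k : ℤ) : ZMod (2 * L + 1))).valMinAbs : ℤ) with hw
    -- geometry of the representative `x' = z + w`
    have hnw : ‖siteToE w‖ = torusDist L x z := norm_wrep L z x
    have htw : a β * ‖siteToE w‖ < Rf := by rw [hnw]; exact hxd
    have hwM : ‖siteToE w‖ ≤ (M : ℝ) / 2 := by
      have h2 : a β * ‖siteToE w‖ ≤ a β * ((M : ℝ) / 2) := by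
        have e : a β * ((M : ℝ) / 2) = 2 * (M : ℝ) * a β / 4 := by ring
        rw [e]; linarith only [htw, hRfs, hM2t]
      exact le_of_mul_le_mul_left h2 ht0
    have h2w : ∀ j, 2 * |w j| ≤ (M : ℤ) := by
      intro j
      have h1 : |((w j : ℤ) : ℝ)| ≤ (M : ℝ) / 2 := (abs_apply_le_norm w j).trans hwM
      have h2 : ((2 * |w j| : ℤ) : ℝ) ≤ ((M : ℤ) : ℝ) := by push_cast; linarith only [h1]
      exact_mod_cast h2
    have hwj : ∀ j, |w j| + 1 ≤ (M : ℤ) := fun j => by have := h2w j; omega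
    have hwN : ∀ j, |w j| ≤ ((M / 2 : ℕ) : ℤ) := fun j => by have := h2w j; omega
    have hcong : ∀ k, ((x k : ℤ) : ZMod (2 * L + 1)) = (((z + w) k : ℤ) : ZMod (2 * L + 1)) :=
      fun k => (intCast_add_wrep L z x k).symm
    rw [torusK3_congr_left r β L hcong y z]
    set x' : Fin 4 → ℤ := z + w with hx'
    -- FBL at `x'` inside `Qz`
    have hdepth' : M + 2 - M / 2 ≤ depth (fun k => z k - (M + 1)) (2 * M + 3) x' :=
      depth_centred_shift_ge z w M (M / 2) hwN
    have hdepth2 : 2 ≤ depth (fun k => z k - (M + 1)) (2 * M + 3) x' := by omega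
    have hdepthR : (M : ℝ) / 2 ≤ (depth (fun k => z k - (M + 1)) (2 * M + 3) x' : ℝ) := by
      have h1 : ((M + 2 - M / 2 : ℕ) : ℝ) ≤ (depth (fun k => z k - (M + 1)) (2 * M + 3) x' : ℝ) := by
        exact_mod_cast hdepth'
      have h2 : M ≤ 2 * (M + 2 - M / 2) := by omega
      have h3 : (M : ℝ) ≤ 2 * ((M + 2 - M / 2 : ℕ) : ℝ) := by exact_mod_cast h2
      linarith only [h1, h3]
    have hFx' : ∀ η, |kerE G r β (fun k => z k - (M + 1)) (2 * M + 3) η (dens G r x') - p β| ≤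
        16 * C₁ / (M : ℝ) ^ 4 := by
      intro η
      refine (hF β hβ1 (fun k => z k - (M + 1)) (2 * M + 3) hb₁ η x' hdepth2).trans ?_
      have hd0 : (0 : ℝ) < (depth (fun k => z k - (M + 1)) (2 * M + 3) x' : ℝ) := by linarith only [hdepthR, hMpos]
      rw [div_le_div_iff₀ (by positivity) (by positivity)]
      have h4 : ((M : ℝ) / 2) ^ 4 ≤ (depth (fun k => z k - (M + 1)) (2 * M + 3) x' : ℝ) ^ 4 :=
        pow_le_pow_left₀ (by positivity) hdepthR 4
      have e4 : ((M : ℝ) / 2) ^ 4 = (M : ℝ) ^ 4 / 16 := by ring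
      have h5 : (M : ℝ) ^ 4 ≤ 16 * (depth (fun k => z k - (M + 1)) (2 * M + 3) x' : ℝ) ^ 4 := by
        rw [e4] at h4; linarith only [h4]
      have h6 := mul_le_mul_of_nonneg_left h5 hC₁
      linarith only [h6]
    -- torus mean of `dens x'` and exterior-uniform deviation
    have hcylx' : IsCylinder (dens G r x') Qz := isCylinder_dens_cube_shift r z w hwj
    obtain ⟨mx, hmx⟩ : ∃ m : ℝ, m = torusE G r β L (dens G r x') := ⟨_, rfl⟩
    have hmx_p : |mx - p β| ≤ 16 * C₁ / (M : ℝ) ^ 4 := by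
      rw [hmx]
      exact abs_torusMean_sub_le r β Qz Qz (continuous_dens r x') (fun U => hCA _) hcylx' hinj_z hFx'
    have hdx : ∀ η, |kerE G r β (fun k => z k - (M + 1)) (2 * M + 3) η (dens G r x') - mx| ≤
        32 * C₁ / (M : ℝ) ^ 4 := by
      intro η
      have e : kerE G r β (fun k => z k - (M + 1)) (2 * M + 3) η (dens G r x') - mx =
          (kerE G r β (fun k => z k - (M + 1)) (2 * M + 3) η (dens G r x') - p β) - (mx - p β) := by ring
      rw [e]
      calc |(kerE G r β (fun k => z k - (M + 1)) (2 * M + 3) η (dens G r x') - p β) - (mx - p β)|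
          ≤ |kerE G r β (fun k => z k - (M + 1)) (2 * M + 3) η (dens G r x') - p β| + |mx - p β| := abs_sub _ _
        _ ≤ 16 * C₁ / (M : ℝ) ^ 4 + 16 * C₁ / (M : ℝ) ^ 4 := add_le_add (hFx' η) hmx_p
        _ = 32 * C₁ / (M : ℝ) ^ 4 := by ring
    -- the near-pair law at `(z, w)` in `Qz`
    have hcovx : ∀ η, |kerCov G r β (fun k => z k - (M + 1)) (2 * M + 3) η (dens G r x') (dens G r z) - n β w| ≤
        μ β w / (M : ℝ) ^ 4 := by
      intro η
      have hdep : 2 * ‖siteToE w‖ + 2 ≤ (depth (fun k => z k - (M + 1)) (2 * M + 3) z : ℝ) := by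
        rw [hdepth_z]; push_cast; linarith only [hwM]
      refine (hcov β hβ2 (fun k => z k - (M + 1)) (2 * M + 3) hb₂ η z w (htw.trans_le hRfR) hdep).trans ?_
      rw [hdepth_z]
      refine div_le_div_of_nonneg_left (hμ0 β w) (by positivity) ?_
      push_cast
      exact pow_le_pow_left₀ hMpos.le (by linarith only) 4
    -- the near observable `W` and its kernel mean
    set W : LGConfig 4 G → ℝ := fun U => (dens G r x' U - mx) * (dens G r z U - mz) with hWdef
    set ε₂ : ℝ := μ β w / (M : ℝ) ^ 4 + 64 * C₁' ^ 2 / (M : ℝ) ^ 8 with hε₂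
    have hε₂0 : 0 < ε₂ := by
      have : 0 ≤ μ β w / (M : ℝ) ^ 4 := div_nonneg (hμ0 β w) (by positivity)
      rw [hε₂]; positivity
    have hWc : Continuous W :=
      ((continuous_dens r x').sub continuous_const).mul ((continuous_dens r z).sub continuous_const)
    have hWb : ∀ U, |W U| ≤ (CA + |mx|) * (CA + |mz|) := fun U => by
      simp only [hWdef]
      rw [abs_mul]
      have h1 : |dens G r x' U - mx| ≤ CA + |mx| := (abs_sub _ _).trans (add_le_add (hCA _) le_rfl)
      have h2 : |dens G r z U - mz| ≤ CA + |mz| := (abs_sub _ _).trans (add_le_add (hCA _) le_rfl)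
      exact mul_le_mul h1 h2 (abs_nonneg _) ((abs_nonneg _).trans h1)
    have hcylz : IsCylinder (dens G r z) Qz := isCylinder_dens_cube r hM1 z
    have hWcyl : IsCylinder W Qz := by
      intro U V hUV
      have h1 : dens G r x' U = dens G r x' V := hcylx' hUV
      have h2 : dens G r z U = dens G r z V := hcylz hUV
      show (dens G r x' U - mx) * (dens G r z U - mz) = (dens G r x' V - mx) * (dens G r z V - mz)
      rw [h1, h2]
    have hWker : ∀ η, |(∫ U, W U ∂(ymSpecification r.ρ β Qz η)) - n β w| ≤ ε₂ := by
      intro η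
      have e1 : (∫ U, W U ∂(ymSpecification r.ρ β Qz η)) =
          kerCov G r β (fun k => z k - (M + 1)) (2 * M + 3) η (dens G r x') (dens G r z) +
            (kerE G r β (fun k => z k - (M + 1)) (2 * M + 3) η (dens G r x') - mx) *
              (kerE G r β (fun k => z k - (M + 1)) (2 * M + 3) η (dens G r z) - mz) :=
        kerE_centred_mul r β (fun k => z k - (M + 1)) (2 * M + 3) η (continuous_dens r x') (continuous_dens r z)
          (fun U => hCA _) (fun U => hCA _) mx mz
      rw [e1]
      have e2 : kerCov G r β (fun k => z k - (M + 1)) (2 * M + 3) η (dens G r x') (dens G r z) +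
            (kerE G r β (fun k => z k - (M + 1)) (2 * M + 3) η (dens G r x') - mx) *
              (kerE G r β (fun k => z k - (M + 1)) (2 * M + 3) η (dens G r z) - mz) - n β w =
          (kerCov G r β (fun k => z k - (M + 1)) (2 * M + 3) η (dens G r x') (dens G r z) - n β w) +
            (kerE G r β (fun k => z k - (M + 1)) (2 * M + 3) η (dens G r x') - mx) *
              (kerE G r β (fun k => z k - (M + 1)) (2 * M + 3) η (dens G r z) - mz) := by ring
      rw [e2]
      refine (abs_add_le _ _).trans ?_
      rw [abs_mul]
      have h3 : |kerE G r β (fun k => z k - (M + 1)) (2 * M + 3) η (dens G r x') - mx| *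
          |kerE G r β (fun k => z k - (M + 1)) (2 * M + 3) η (dens G r z) - mz| ≤
          (32 * C₁ / (M : ℝ) ^ 4) * (2 * C₁ / (M : ℝ) ^ 4) :=
        mul_le_mul (hdx η) (hdz η) (abs_nonneg _) (by positivity)
      have h4 : (32 * C₁ / (M : ℝ) ^ 4) * (2 * C₁ / (M : ℝ) ^ 4) ≤ 64 * C₁' ^ 2 / (M : ℝ) ^ 8 := by
        have hc : C₁ ^ 2 ≤ C₁' ^ 2 := pow_le_pow_left₀ hC₁ hC₁le 2
        have e3 : (32 * C₁ / (M : ℝ) ^ 4) * (2 * C₁ / (M : ℝ) ^ 4) = 64 * C₁ ^ 2 / (M : ℝ) ^ 8 := by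
          field_simp; ring
        rw [e3]
        exact div_le_div_of_nonneg_right (by linarith only [hc]) (by positivity)
      rw [hε₂]
      linarith only [hcovx η, h3, h4]
    -- the two-observable collar bound and the identity `κ₃ = ⟨(dens y − m_y)(W − ⟨W⟩)⟩`
    have hcollar := abs_integral_two_sub_mean_le r β (L' := 2 * L + 1) Qy Qy Qz Qz (continuous_dens r y) hWc
      (fun U => hCA _) hWb (isCylinder_dens_cube r hM1 y) hWcyl hinj_y hinj_z hfar_yz hfar_zy hε₁0 hε₂0 hyker hWker
    rw [torusK3_eq_integral_centred r β L x' y z mx mz hmx hmz, ← hWdef]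
    exact hcollar
  ----------------------------------------------------------------------------------------------
  -- summation over the near ball
  ----------------------------------------------------------------------------------------------
  rw [← Finset.sum_filter]
  set B : Finset (Fin 4 → ℤ) := (box 4 L).filter (fun x => a β * torusDist L x z < Rf) with hB
  set wr : (Fin 4 → ℤ) → (Fin 4 → ℤ) := fun x k => ((((x k - z k : ℤ) : ZMod (2 * L + 1))).valMinAbs : ℤ) with hwr
  have hstep : ∑ x ∈ B, |torusK3 G r β L x y z| ≤
      ∑ x ∈ B, (4 * ε₁ / (M : ℝ) ^ 4 * μ β (wr x) + 4 * ε₁ * (64 * C₁' ^ 2 / (M : ℝ) ^ 8)) := by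
    refine Finset.sum_le_sum fun x hx => (key x hx).trans (le_of_eq ?_)
    simp only [hwr]
    ring
  rw [Finset.sum_add_distrib, ← Finset.mul_sum, Finset.sum_const, nsmul_eq_mul] at hstep
  -- `Σ μ ≤ κ'` over the representatives
  have hinjB : Set.InjOn wr B := (hwr ▸ wrep_injOn L z).mono fun x hx => by
    simp only [hB, Finset.coe_filter, Set.mem_setOf_eq] at hx
    exact Finset.mem_coe.2 hx.1
  have hμB : ∑ x ∈ B, μ β (wr x) ≤ κ' := by
    rw [← Finset.sum_image (g := wr) (f := fun w => μ β w) fun x hx x' hx' h => hinjB hx hx' h]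
    refine hμsum β _ hβ2 fun w hw => ?_
    obtain ⟨x, hx, rfl⟩ := Finset.mem_image.1 hw
    rw [hB, Finset.mem_filter] at hx
    rw [hwr, norm_wrep]
    exact hx.2.trans_le hRfR
  -- the count of the near ball
  have hcardB : (B.card : ℝ) ≤ (2 * (Rf / a β) + 1) ^ 4 := by
    have hB' : B = (box 4 L).filter (fun x => torusDist L x z < Rf / a β) := by
      rw [hB]
      refine Finset.filter_congr fun x _ => ?_
      rw [lt_div_iff₀ ht0, mul_comm]
    rw [hB']
    exact card_filter_torusDist_lt_le L z (by positivity)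
  -- arithmetic
  have hMinv : 1 / (M : ℝ) ≤ 2 * a β / s := by
    rw [div_le_div_iff₀ hMpos hs0]; linarith only [hM2t]
  have hT1 : 4 * ε₁ / (M : ℝ) ^ 4 * κ' ≤ κ * a β ^ 8 / 2 := by
    have e1 : 4 * ε₁ / (M : ℝ) ^ 4 * κ' = (κ * s ^ 8 / 512) * (1 / (M : ℝ)) ^ 8 := by
      rw [hε₁, hκ']; field_simp; ring
    rw [e1]
    have h8 : (1 / (M : ℝ)) ^ 8 ≤ (2 * a β / s) ^ 8 := pow_le_pow_left₀ (by positivity) hMinv 8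
    calc κ * s ^ 8 / 512 * (1 / (M : ℝ)) ^ 8 ≤ κ * s ^ 8 / 512 * (2 * a β / s) ^ 8 :=
          mul_le_mul_of_nonneg_left h8 (by positivity)
      _ = κ * a β ^ 8 / 2 := by field_simp; ring
  have hT2 : (B.card : ℝ) * (4 * ε₁ * (64 * C₁' ^ 2 / (M : ℝ) ^ 8)) ≤ κ * a β ^ 8 / 2 := by
    have e1 : 4 * ε₁ * (64 * C₁' ^ 2 / (M : ℝ) ^ 8) = 256 * C₁' ^ 3 * (1 / (M : ℝ)) ^ 12 := by
      rw [hε₁]; field_simp; ring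
    rw [e1]
    have h12 : (1 / (M : ℝ)) ^ 12 ≤ (2 * a β / s) ^ 12 := pow_le_pow_left₀ (by positivity) hMinv 12
    have hc4 : (B.card : ℝ) * a β ^ 4 ≤ (3 * Rf) ^ 4 := by
      calc (B.card : ℝ) * a β ^ 4 ≤ (2 * (Rf / a β) + 1) ^ 4 * a β ^ 4 :=
            mul_le_mul_of_nonneg_right hcardB (by positivity)
        _ = (2 * Rf + a β) ^ 4 := by field_simp
        _ ≤ (3 * Rf) ^ 4 := pow_le_pow_left₀ (by positivity) (by linarith only [htR]) 4
    have hRf4 : Rf ^ 4 ≤ Rf := pow_le_of_le_one hRf0.le hRf1 (by norm_num)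
    have hRfκ' : 2 ^ 21 * 81 * C₁' ^ 3 * Rf ≤ κ * s ^ 12 := by
      have := (le_div_iff₀ (by positivity : (0 : ℝ) < 2 ^ 21 * 81 * C₁' ^ 3)).1 hRfκ
      linarith only [this]
    calc (B.card : ℝ) * (256 * C₁' ^ 3 * (1 / (M : ℝ)) ^ 12)
        ≤ (B.card : ℝ) * (256 * C₁' ^ 3 * (2 * a β / s) ^ 12) := by
          refine mul_le_mul_of_nonneg_left (mul_le_mul_of_nonneg_left h12 (by positivity)) (by positivity)
      _ = ((B.card : ℝ) * a β ^ 4) * (2 ^ 20 * C₁' ^ 3 * a β ^ 8 / s ^ 12) := by field_simp; ring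
      _ ≤ (3 * Rf) ^ 4 * (2 ^ 20 * C₁' ^ 3 * a β ^ 8 / s ^ 12) :=
          mul_le_mul_of_nonneg_right hc4 (by positivity)
      _ = 81 * Rf ^ 4 * (2 ^ 20 * C₁' ^ 3 * a β ^ 8 / s ^ 12) := by ring
      _ ≤ 81 * Rf * (2 ^ 20 * C₁' ^ 3 * a β ^ 8 / s ^ 12) := by
          refine mul_le_mul_of_nonneg_right ?_ (by positivity)
          linarith only [hRf4]
      _ = (2 ^ 21 * 81 * C₁' ^ 3 * Rf) * (a β ^ 8 / (2 * s ^ 12)) := by field_simp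
      _ ≤ (κ * s ^ 12) * (a β ^ 8 / (2 * s ^ 12)) := mul_le_mul_of_nonneg_right hRfκ' (by positivity)
      _ = κ * a β ^ 8 / 2 := by field_simp
  have hμB' := mul_le_mul_of_nonneg_left hμB (by positivity : (0 : ℝ) ≤ 4 * ε₁ / (M : ℝ) ^ 4)
  linarith only [hstep, hμB', hT1, hT2]

end Main

end Summit.QuantumFields.YangMills.Cruxes.ResponseLocalisation.Femto

end
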